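import Literature.AlgebraicTopology.Homotopy.WhiteheadCWContractible
import Mathlib.Analysis.Normed.Module.Convex
import HarnessLib

/-!
# Maps on the boundary of a box extend inside when the homotopy group vanishes

Topic `Literature/AlgebraicTopology/Homotopy`. The free form of the vanishing of a homotopy
group, absent from Mathlib (which has `π_m(X, x)` as classes of maps `(I^m, ∂I^m) → (X, x)` but
no statement about maps of spheres without base point condition):

* `Literature.AlgebraicTopology.Homotopy.BoxExt.exists_extension`: let `X` be path connected with
  `π_m(X, x) = HomotopyGroup (Fin m) X x` trivial for every `x`. Then every map defined and
  continuous on the boundary `∂B = (D × {0, 1}) ∪ (S × [0, 1])` of the box `B = D × [0, 1]`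
  (`D` the closed unit ball of `Fin m → ℝ` in the sup norm, i.e. the cube `[-1, 1]^m`, `S` its
  boundary sphere; `∂B ≅ S^m`) extends continuously to `B`. (The hypothesis on `π_m` is only
  asked for `m ≥ 1`; for `m = 0` path-connectedness is what is used.)

This is the standard equivalence "`πₘ(X, x₀) = 0` for all `x₀` (and `X` path connected) iff
every map `Sᵐ → X` extends over `Dᵐ⁺¹`" (Hatcher, *Algebraic Topology* (2002), §4.1, p. 346:
"`πₙ(X, x₀) = 0` … iff every map `Sⁿ → X` is homotopic to a constant map … iff every such map
extends to a map `Dⁿ⁺¹ → X`", via Lemma 4.5/`β_γ` change of base point). Proof: the data on the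
closed box without lid `L = (D × {0}) ∪ (S × [0, 1])` is deformed to a constant through the
radial filling of the box (`WhiteheadCW.boxFill`: `L` is a retract of the convex box), the
deformation is extended over the lid by the homotopy extension property of `(D, S)` (the same
filling one dimension down), the resulting data — constant off the lid, a map `(D, S) → (X, x₁)`
on the lid — extends by the vanishing of `π_m(X, x₁)` (`WhiteheadCW.exists_box_extension`), and
an extension is transported back along the deformation through a collar of `∂B` in `B`.
Everything is proved; no named facts. Used for the Eilenberg deformation of singular chains of
highly connected spaces (Hurewicz theorem, `Literature/AlgebraicTopology/SingularHomology/`).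

## References

* A. Hatcher, *Algebraic Topology*, CUP (2002), §4.1, p. 346 (criteria for `πₙ = 0`), Lemma 4.7,
  Prop. 0.16. [HatcherAT2002]
-/

noncomputable section

open Set Metric Topology unitInterval Function
open scoped Topology Topology.Homotopy

namespace Literature.AlgebraicTopology.Homotopy

namespace BoxExt

open WhiteheadCW

variable {m : ℕ} {X : Type*} [TopologicalSpace X]

/-- Local notation: the model cube `D` and sphere `S` of dimension `m` (sup norm). -/
local notation "D" => closedBall (0 : Fin m → ℝ) 1
local notation "S" => sphere (0 : Fin m → ℝ) 1

/-- The boundary of the box `D × [0, 1]`: bottom, top and sides. [folklore] -/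
def boxBoundary (m : ℕ) : Set ((Fin m → ℝ) × ℝ) :=
  (closedBall (0 : Fin m → ℝ) 1 ×ˢ {0, 1}) ∪ (sphere (0 : Fin m → ℝ) 1 ×ˢ Icc (0 : ℝ) 1)

/-- The closed box without lid `L`: bottom and sides. [folklore] -/
def noLid (m : ℕ) : Set ((Fin m → ℝ) × ℝ) :=
  (closedBall (0 : Fin m → ℝ) 1 ×ˢ {0}) ∪ (sphere (0 : Fin m → ℝ) 1 ×ˢ Icc (0 : ℝ) 1)

/-- Unfolding of `boxBoundary`. [folklore] -/
theorem mem_boxBoundary {p : (Fin m → ℝ) × ℝ} : p ∈ boxBoundary m ↔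
    (p.1 ∈ D ∧ (p.2 = 0 ∨ p.2 = 1)) ∨ (p.1 ∈ S ∧ p.2 ∈ Icc (0 : ℝ) 1) := by
  simp [boxBoundary, mem_insert_iff]

/-- Unfolding of `noLid`. [folklore] -/
theorem mem_noLid {p : (Fin m → ℝ) × ℝ} : p ∈ noLid m ↔
    (p.1 ∈ D ∧ p.2 = 0) ∨ (p.1 ∈ S ∧ p.2 ∈ Icc (0 : ℝ) 1) := by
  simp [noLid]

/-- `L ⊆ ∂B`. [folklore] -/
theorem noLid_subset_boxBoundary : noLid m ⊆ boxBoundary m := by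
  intro p hp
  rw [mem_noLid] at hp
  rw [mem_boxBoundary]
  rcases hp with ⟨h1, h2⟩ | h
  · exact Or.inl ⟨h1, Or.inl h2⟩
  · exact Or.inr h

/-- `∂B ⊆ B`. [folklore] -/
theorem boxBoundary_subset_box : boxBoundary m ⊆ D ×ˢ Icc (0 : ℝ) 1 := by
  intro p hp
  rw [mem_boxBoundary] at hp
  rcases hp with ⟨h1, h2 | h2⟩ | ⟨h1, h2⟩
  · exact ⟨h1, by rw [h2]; exact ⟨le_rfl, zero_le_one⟩⟩
  · exact ⟨h1, by rw [h2]; exact ⟨zero_le_one, le_rfl⟩⟩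
  · exact ⟨sphere_subset_closedBall h1, h2⟩

/-- `L ⊆ B`. [folklore] -/
theorem noLid_subset_box : noLid m ⊆ D ×ˢ Icc (0 : ℝ) 1 :=
  noLid_subset_boxBoundary.trans boxBoundary_subset_box

/-- The box is convex. [folklore] -/
theorem convex_box : Convex ℝ (D ×ˢ Icc (0 : ℝ) 1 : Set ((Fin m → ℝ) × ℝ)) :=
  (convex_closedBall 0 1).prod (convex_Icc 0 1)

/-! ### The filling of the box from the no-lid data, and its use as a retraction -/

/-- The filling `boxFill 1 (φ (·, 0)) φ` of the whole box from data on `L`: continuous on the box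
when `φ` is continuous on `L`. [folklore] -/
theorem fill_continuousOn {φ : (Fin m → ℝ) × ℝ → X} (hφ : ContinuousOn φ (noLid m)) :
    ContinuousOn (boxFill 1 (fun w => φ (w, 0)) φ) (D ×ˢ Icc (0 : ℝ) 1) := by
  refine boxFill_continuousOn one_pos le_rfl ?_ ?_ (fun _ _ => rfl)
  · exact hφ.comp (Continuous.prodMk_left 0).continuousOn
      fun w hw => mem_noLid.2 (Or.inl ⟨hw, rfl⟩)
  · exact hφ.mono fun p hp => mem_noLid.2 (Or.inr hp)

omit [TopologicalSpace X] in
/-- On `L` the filling is the data. [folklore] -/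
theorem fill_of_mem_noLid {φ : (Fin m → ℝ) × ℝ → X} {p : (Fin m → ℝ) × ℝ} (hp : p ∈ noLid m) :
    boxFill 1 (fun w => φ (w, 0)) φ p = φ p := by
  obtain ⟨w, t⟩ := p
  rcases mem_noLid.1 hp with ⟨hw, ht⟩ | ⟨hw, ht⟩
  · dsimp only at ht; subst ht
    exact boxFill_bottom one_pos hw
  · exact boxFill_side one_pos (fun w hw => rfl) hw ht

/-! ### The main theorem -/

/-- The box centre. [folklore] -/
def ctr (m : ℕ) : (Fin m → ℝ) × ℝ := (0, 1 / 2)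

/-- The box gauge about the centre: `ν(w, t) = max ‖w‖ (2 |t|)`, so that
`B = ctr + {ν ≤ 1}` and `∂B = ctr + {ν = 1}`. [folklore] -/
def ν (v : (Fin m → ℝ) × ℝ) : ℝ := max ‖v.1‖ (2 * |v.2|)

/-- `ν ≥ 0`. [folklore] -/
theorem ν_nonneg (v : (Fin m → ℝ) × ℝ) : 0 ≤ ν v := le_max_of_le_left (norm_nonneg _)

/-- `ν` is continuous. [folklore] -/
@[fun_prop]
theorem continuous_ν : Continuous (ν : (Fin m → ℝ) × ℝ → ℝ) := by
  unfold ν; fun_prop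

/-- `ν` is positively homogeneous. [folklore] -/
theorem ν_smul {c : ℝ} (hc : 0 ≤ c) (v : (Fin m → ℝ) × ℝ) : ν (c • v) = c * ν v := by
  simp only [ν, Prod.smul_fst, Prod.smul_snd, norm_smul, Real.norm_eq_abs, abs_of_nonneg hc,
    smul_eq_mul, abs_mul]
  rw [mul_max_of_nonneg _ _ hc]
  ring_nf

/-- `2 |a| ≤ 1 ↔ -1/2 ≤ a ≤ 1/2`. [folklore] -/
theorem two_mul_abs_le_one_iff (a : ℝ) : 2 * |a| ≤ 1 ↔ -(1 / 2) ≤ a ∧ a ≤ 1 / 2 := by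
  rcases le_or_gt 0 a with ha | ha
  · rw [abs_of_nonneg ha]; constructor <;> intro h <;> [exact ⟨by linarith, by linarith⟩; linarith]
  · rw [abs_of_neg ha]; constructor <;> intro h <;> [exact ⟨by linarith, by linarith⟩; linarith]

/-- `2 |a| = 1 ↔ a = ± 1/2`. [folklore] -/
theorem two_mul_abs_eq_one_iff (a : ℝ) : 2 * |a| = 1 ↔ a = 1 / 2 ∨ a = -(1 / 2) := by
  rcases le_or_gt 0 a with ha | ha
  · rw [abs_of_nonneg ha]; constructor <;> intro h
    · left; linarith
    · rcases h with h | h <;> linarith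
  · rw [abs_of_neg ha]; constructor <;> intro h
    · right; linarith
    · rcases h with h | h <;> linarith

/-- A point `ctr + v` lies in the box iff `ν v ≤ 1`. [folklore] -/
theorem ctr_add_mem_box_iff (v : (Fin m → ℝ) × ℝ) :
    ctr m + v ∈ (D ×ˢ Icc (0 : ℝ) 1 : Set ((Fin m → ℝ) × ℝ)) ↔ ν v ≤ 1 := by
  simp only [ctr, mem_prod, Prod.fst_add, zero_add, mem_closedBall_zero_iff, Prod.snd_add, mem_Icc,
    ν, max_le_iff, two_mul_abs_le_one_iff]
  constructor
  · rintro ⟨h1, h2, h3⟩; exact ⟨h1, by linarith, by linarith⟩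
  · rintro ⟨h1, h2, h3⟩; exact ⟨h1, by linarith, by linarith⟩

/-- `max a b = 1 ↔ (a = 1 ∧ b ≤ 1) ∨ (b = 1 ∧ a ≤ 1)`. [folklore] -/
theorem max_eq_one_iff (a b : ℝ) : max a b = 1 ↔ (a = 1 ∧ b ≤ 1) ∨ (b = 1 ∧ a ≤ 1) := by
  rw [max_eq_iff]
  constructor
  · rintro (⟨h1, h2⟩ | ⟨h1, h2⟩)
    · exact Or.inl ⟨h1, h1 ▸ h2⟩
    · exact Or.inr ⟨h1, h1 ▸ h2⟩
  · rintro (⟨h1, h2⟩ | ⟨h1, h2⟩)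
    · exact Or.inl ⟨h1, h1.symm ▸ h2⟩
    · exact Or.inr ⟨h1, h1.symm ▸ h2⟩

/-- A point `ctr + v` lies on the box boundary iff `ν v = 1`. [folklore] -/
theorem ctr_add_mem_boxBoundary_iff (v : (Fin m → ℝ) × ℝ) :
    ctr m + v ∈ boxBoundary m ↔ ν v = 1 := by
  rw [mem_boxBoundary]
  simp only [ctr, Prod.fst_add, zero_add, mem_closedBall_zero_iff, Prod.snd_add, mem_Icc,
    mem_sphere_zero_iff_norm, ν, max_eq_one_iff, two_mul_abs_le_one_iff, two_mul_abs_eq_one_iff]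
  constructor
  · rintro (⟨h1, h2 | h2⟩ | ⟨h1, h2, h3⟩)
    · right; exact ⟨Or.inr (by linarith), h1⟩
    · right; exact ⟨Or.inl (by linarith), h1⟩
    · left; exact ⟨h1, by linarith, by linarith⟩
  · rintro (⟨h1, h2, h3⟩ | ⟨h1 | h1, h2⟩)
    · right; exact ⟨h1, by linarith, by linarith⟩
    · left; exact ⟨h2, Or.inr (by linarith)⟩
    · left; exact ⟨h2, Or.inl (by linarith)⟩

/-! ### Step 1: deforming the no-lid data to a constant -/

/-- Scaling towards the origin keeps the box. [folklore] -/
theorem smul_mem_box {p : (Fin m → ℝ) × ℝ} (hp : p ∈ (D ×ˢ Icc (0 : ℝ) 1 : Set ((Fin m → ℝ) × ℝ)))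
    {a : ℝ} (ha0 : 0 ≤ a) (ha1 : a ≤ 1) : a • p ∈ (D ×ˢ Icc (0 : ℝ) 1 : Set ((Fin m → ℝ) × ℝ)) := by
  obtain ⟨hw, ht⟩ := hp
  refine ⟨?_, ?_⟩
  · rw [Prod.smul_fst, mem_closedBall_zero_iff, norm_smul, Real.norm_eq_abs, abs_of_nonneg ha0]
    rw [mem_closedBall_zero_iff] at hw
    nlinarith [norm_nonneg p.1]
  · rw [Prod.smul_snd, smul_eq_mul]
    exact ⟨mul_nonneg ha0 ht.1, by nlinarith [ht.2]⟩

/-- The deformation of the no-lid data: `h(s, p) = F((1 - s) p)`, `F` the filling of the box from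
the data on `L` (so `h₀ = φ` on `L`, `h₁ ≡ φ(0)`). [folklore] -/
def hFun (φ : (Fin m → ℝ) × ℝ → X) (z : ℝ × ((Fin m → ℝ) × ℝ)) : X :=
  boxFill 1 (fun w => φ (w, 0)) φ ((1 - z.1) • z.2)

/-- The deformation is continuous on `[0, 1] × B`. [folklore] -/
theorem hFun_continuousOn {φ : (Fin m → ℝ) × ℝ → X} (hφ : ContinuousOn φ (noLid m)) :
    ContinuousOn (hFun φ) (Icc (0 : ℝ) 1 ×ˢ (D ×ˢ Icc (0 : ℝ) 1)) := by
  refine (fill_continuousOn hφ).comp (by fun_prop) ?_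
  rintro ⟨s, p⟩ ⟨hs, hp⟩
  exact smul_mem_box hp (by linarith [hs.2]) (by linarith [hs.1])

omit [TopologicalSpace X] in
/-- At `s = 0` the deformation is the data (on `L`). [folklore] -/
theorem hFun_zero {φ : (Fin m → ℝ) × ℝ → X} {p : (Fin m → ℝ) × ℝ} (hp : p ∈ noLid m) :
    hFun φ (0, p) = φ p := by
  simp only [hFun, sub_zero, one_smul]
  exact fill_of_mem_noLid hp

omit [TopologicalSpace X] in
/-- At `s = 1` the deformation is the constant `φ 0`. [folklore] -/
theorem hFun_one (φ : (Fin m → ℝ) × ℝ → X) (p : (Fin m → ℝ) × ℝ) : hFun φ (1, p) = φ 0 := by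
  simp only [hFun, sub_self, zero_smul]
  have h0 : ((0 : Fin m → ℝ), (0 : ℝ)) ∈ noLid m :=
    mem_noLid.2 (Or.inl ⟨mem_closedBall_self zero_le_one, rfl⟩)
  exact fill_of_mem_noLid h0

/-! ### Step 2: extending the deformation over the lid -/

/-- The deformation restricted to the rim `S × {1}`, as side data over the lid. [folklore] -/
def kFun (φ : (Fin m → ℝ) × ℝ → X) (q : (Fin m → ℝ) × ℝ) : X := hFun φ (q.2, (q.1, 1))

/-- The rim data is continuous on `S × [0, 1]`. [folklore] -/
theorem kFun_continuousOn {φ : (Fin m → ℝ) × ℝ → X} (hφ : ContinuousOn φ (noLid m)) :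
    ContinuousOn (kFun φ) (S ×ˢ Icc (0 : ℝ) 1) := by
  refine (hFun_continuousOn hφ).comp (by fun_prop) ?_
  rintro ⟨w, s⟩ ⟨hw, hs⟩
  exact ⟨hs, sphere_subset_closedBall hw, zero_le_one, le_rfl⟩

omit [TopologicalSpace X] in
/-- The rim data starts at the lid data. [folklore] -/
theorem kFun_zero (φ : (Fin m → ℝ) × ℝ → X) {w : Fin m → ℝ} (hw : w ∈ S) :
    kFun φ (w, 0) = φ (w, 1) :=
  hFun_zero (mem_noLid.2 (Or.inr ⟨hw, zero_le_one, le_rfl⟩))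

/-- The homotopy of the lid (homotopy extension property of `(D, S)`: the filling one dimension
down), `K(w, s)`: starts at the lid data and follows the rim data on `S`. [folklore] -/
def KFun (φ : (Fin m → ℝ) × ℝ → X) : (Fin m → ℝ) × ℝ → X := boxFill 1 (fun w => φ (w, 1)) (kFun φ)

/-- The lid homotopy is continuous on `D × [0, 1]`. [folklore] -/
theorem KFun_continuousOn {φ : (Fin m → ℝ) × ℝ → X} (hφ : ContinuousOn φ (boxBoundary m)) :
    ContinuousOn (KFun φ) (D ×ˢ Icc (0 : ℝ) 1) := by
  refine boxFill_continuousOn one_pos le_rfl ?_ (kFun_continuousOn (hφ.mono noLid_subset_boxBoundary))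
    (fun _ hw => kFun_zero φ hw)
  exact hφ.comp (Continuous.prodMk_left 1).continuousOn
    fun w hw => mem_boxBoundary.2 (Or.inl ⟨hw, Or.inr rfl⟩)

omit [TopologicalSpace X] in
/-- The lid homotopy starts at the lid data. [folklore] -/
theorem KFun_zero (φ : (Fin m → ℝ) × ℝ → X) {w : Fin m → ℝ} (hw : w ∈ D) : KFun φ (w, 0) = φ (w, 1) :=
  boxFill_bottom one_pos hw

omit [TopologicalSpace X] in
/-- On the rim the lid homotopy is the rim data. [folklore] -/
theorem KFun_side (φ : (Fin m → ℝ) × ℝ → X) {w : Fin m → ℝ} (hw : w ∈ S) {s : ℝ}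
    (hs : s ∈ Icc (0 : ℝ) 1) : KFun φ (w, s) = kFun φ (w, s) :=
  boxFill_side one_pos (fun _ hw => kFun_zero φ hw) hw hs

/-- The deformation of the whole boundary data: the lid homotopy on the lid, `h` elsewhere.
[folklore] -/
def fFun (φ : (Fin m → ℝ) × ℝ → X) (z : ℝ × ((Fin m → ℝ) × ℝ)) : X :=
  if z.2.2 = 1 then KFun φ (z.2.1, z.1) else hFun φ z

/-- The lid, `D × {1}`. [folklore] -/
def lid (m : ℕ) : Set ((Fin m → ℝ) × ℝ) := closedBall (0 : Fin m → ℝ) 1 ×ˢ {1}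

/-- `∂B = lid ∪ L`. [folklore] -/
theorem boxBoundary_eq_lid_union_noLid : boxBoundary m = lid m ∪ noLid m := by
  ext p
  rw [mem_boxBoundary, mem_union, mem_noLid, lid, mem_prod, mem_singleton_iff]
  tauto

/-- The lid is closed. [folklore] -/
theorem isClosed_lid : IsClosed (lid m) := isClosed_closedBall.prod isClosed_singleton

/-- `L` is closed. [folklore] -/
theorem isClosed_noLid : IsClosed (noLid m) :=
  (isClosed_closedBall.prod isClosed_singleton).union (isClosed_sphere.prod isClosed_Icc)

/-- The boundary deformation is jointly continuous on `[0, 1] × ∂B`. [folklore] -/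
theorem fFun_continuousOn {φ : (Fin m → ℝ) × ℝ → X} (hφ : ContinuousOn φ (boxBoundary m)) :
    ContinuousOn (fFun φ) (Icc (0 : ℝ) 1 ×ˢ boxBoundary m) := by
  rw [boxBoundary_eq_lid_union_noLid, prod_union]
  refine ContinuousOn.union_of_isClosed ?_ ?_ (isClosed_Icc.prod isClosed_lid)
    (isClosed_Icc.prod isClosed_noLid)
  · -- on the lid: the lid homotopy
    have h1 : ContinuousOn (fun z : ℝ × ((Fin m → ℝ) × ℝ) => KFun φ (z.2.1, z.1))
        (Icc (0 : ℝ) 1 ×ˢ lid m) :=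
      (KFun_continuousOn hφ).comp (by fun_prop) fun z hz => ⟨hz.2.1, hz.1⟩
    refine h1.congr fun z hz => ?_
    have hz2 : z.2.2 = 1 := hz.2.2
    simp [fFun, hz2]
  · -- on `L`: the deformation `h` (on the rim both formulas agree)
    have h1 : ContinuousOn (hFun φ) (Icc (0 : ℝ) 1 ×ˢ noLid m) :=
      (hFun_continuousOn (hφ.mono noLid_subset_boxBoundary)).mono (prod_mono le_rfl noLid_subset_box)
    refine h1.congr fun z hz => ?_
    by_cases hz2 : z.2.2 = 1
    · -- a rim point
      obtain ⟨s, w, t⟩ := z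
      dsimp only at hz2
      subst hz2
      have hw : w ∈ S := by
        rcases mem_noLid.1 hz.2 with ⟨-, h⟩ | ⟨h, -⟩
        · exact absurd h one_ne_zero
        · exact h
      simp only [fFun, if_true]
      rw [KFun_side φ hw hz.1]
      rfl
    · simp [fFun, hz2]

omit [TopologicalSpace X] in
/-- At `s = 0` the boundary deformation is the data `φ`. [folklore] -/
theorem fFun_zero (φ : (Fin m → ℝ) × ℝ → X) {p : (Fin m → ℝ) × ℝ} (hp : p ∈ boxBoundary m) :
    fFun φ (0, p) = φ p := by
  obtain ⟨w, t⟩ := p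
  by_cases ht : t = 1
  · subst ht
    have hw : w ∈ D := by
      rcases mem_boxBoundary.1 hp with ⟨h, -⟩ | ⟨h, -⟩
      · exact h
      · exact sphere_subset_closedBall h
    simp only [fFun, if_true]
    exact KFun_zero φ hw
  · have hp' : (w, t) ∈ noLid m := by
      rcases mem_boxBoundary.1 hp with ⟨h1, h2 | h2⟩ | h
      · exact mem_noLid.2 (Or.inl ⟨h1, h2⟩)
      · exact absurd h2 ht
      · exact mem_noLid.2 (Or.inr h)
    simp only [fFun, ht, if_false]
    exact hFun_zero hp'

omit [TopologicalSpace X] in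
/-- At `s = 1`, off the lid, the boundary deformation is the constant `φ 0`. [folklore] -/
theorem fFun_one_of_ne (φ : (Fin m → ℝ) × ℝ → X) {p : (Fin m → ℝ) × ℝ} (hp : p.2 ≠ 1) :
    fFun φ (1, p) = φ 0 := by
  simp only [fFun, hp, if_false]
  exact hFun_one φ p

omit [TopologicalSpace X] in
/-- At `s = 1`, on the lid, the boundary deformation is the end `K(·, 1)` of the lid homotopy.
[folklore] -/
theorem fFun_one_lid (φ : (Fin m → ℝ) × ℝ → X) (w : Fin m → ℝ) : fFun φ (1, (w, 1)) = KFun φ (w, 1) := by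
  simp [fFun]

omit [TopologicalSpace X] in
/-- The end of the lid homotopy is constant `= φ 0` on the rim. [folklore] -/
theorem KFun_one_of_mem_sphere (φ : (Fin m → ℝ) × ℝ → X) {w : Fin m → ℝ} (hw : w ∈ S) :
    KFun φ (w, 1) = φ 0 := by
  rw [KFun_side φ hw ⟨zero_le_one, le_rfl⟩]
  exact hFun_one φ _

/-! ### Step 3: the deformed data extends (vanishing of `π_m`) -/

/-- Triviality of `π_m(X, x₀)` in the form consumed by `WhiteheadCW.exists_box_extension`: maps of
the cube constant `= x₀` on the boundary are null-homotopic rel boundary (for `m = 0`: the point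
is joined to `x₀` by a path). [folklore] -/
theorem homotopicRel_const_of_subsingleton [PathConnectedSpace X] (x₀ : X)
    (hπ : 1 ≤ m → Subsingleton (π_ m X x₀)) (ψ : C(Fin m → I, X))
    (hψ : ∀ y ∈ Cube.boundary (Fin m), ψ y = x₀) :
    ψ.HomotopicRel (ContinuousMap.const _ x₀) (Cube.boundary (Fin m)) := by
  rcases Nat.eq_zero_or_pos m with hm | hm
  · subst hm
    let y₀ : Fin 0 → I := fun i => i.elim0
    let γ : Path (ψ y₀) x₀ := PathConnectedSpace.somePath _ _
    refine ⟨⟨⟨fun p => γ p.1, γ.continuous.comp continuous_fst⟩, fun y => ?_, fun y => ?_⟩, ?_⟩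
    · show γ 0 = ψ y
      rw [Subsingleton.elim y y₀]; exact γ.source
    · exact γ.target
    · rintro t y ⟨i, -⟩; exact i.elim0
  · haveI : Nonempty (Fin m) := ⟨⟨0, hm⟩⟩
    haveI := hπ hm
    have h : GenLoop.Homotopic (⟨ψ, hψ⟩ : Ω^ (Fin m) X x₀) GenLoop.const :=
      Quotient.exact (Subsingleton.elim (α := HomotopyGroup (Fin m) X x₀) _ _)
    exact h

/-- The data at the end of the deformation — `K(·, 1)` on the lid, constant off it — extends over
the box (by `WhiteheadCW.exists_box_extension`, applied upside down). [folklore] -/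
theorem exists_extension_one [PathConnectedSpace X] (hπ : 1 ≤ m → ∀ x : X, Subsingleton (π_ m X x))
    {φ : (Fin m → ℝ) × ℝ → X} (hφ : ContinuousOn φ (boxBoundary m)) :
    ∃ G : (Fin m → ℝ) × ℝ → X, ContinuousOn G (D ×ˢ Icc (0 : ℝ) 1) ∧
      ∀ p ∈ boxBoundary m, G p = fFun φ (1, p) := by
  set x₁ := φ 0 with hx₁
  have ha : ContinuousOn (fun w => KFun φ (w, 1)) D :=
    (KFun_continuousOn hφ).comp (Continuous.prodMk_left 1).continuousOn
      fun w hw => ⟨hw, zero_le_one, le_rfl⟩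
  obtain ⟨G, hGc, hG0, hGside, hGlate⟩ := exists_box_extension x₁ (m := m) (τ := 1 / 2) (τ' := 1)
    (by norm_num) (by norm_num) le_rfl (homotopicRel_const_of_subsingleton x₁ fun h => hπ h x₁) ha
    (h := fun _ => x₁) continuousOn_const (fun w hw => (KFun_one_of_mem_sphere φ hw).symm)
    (fun w hw t ht => rfl)
  refine ⟨fun p => G (p.1, 1 - p.2), hGc.comp (by fun_prop) ?_, ?_⟩
  · rintro ⟨w, t⟩ ⟨hw, ht⟩
    exact ⟨hw, by linarith [ht.2], by linarith [ht.1]⟩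
  · rintro ⟨w, t⟩ hp
    by_cases ht : t = 1
    · subst ht
      have hw : w ∈ D := by
        rcases mem_boxBoundary.1 hp with ⟨h, -⟩ | ⟨h, -⟩
        · exact h
        · exact sphere_subset_closedBall h
      show G (w, 1 - 1) = fFun φ (1, (w, 1))
      rw [sub_self, hG0 w hw, fFun_one_lid]
    · rw [fFun_one_of_ne φ (p := (w, t)) ht]
      show G (w, 1 - t) = x₁
      rcases mem_boxBoundary.1 hp with ⟨h1, h2 | h2⟩ | ⟨h1, h2⟩
      · dsimp only at h2; subst h2
        rw [sub_zero]
        exact hGlate w h1 1 ⟨le_rfl, le_rfl⟩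
      · exact absurd h2 ht
      · exact hGside w h1 (1 - t) ⟨by linarith [h2.2], by linarith [h2.1]⟩

/-! ### Step 4: transporting the extension back through a collar -/

/-- **Maps on the boundary of a box extend inside when `π_m` vanishes** (Hatcher 2002, §4.1,
p. 346: `πₙ(X, x₀) = 0` for all `x₀` iff every map `Sⁿ → X` extends over `Dⁿ⁺¹`; here
`∂(D × [0,1]) ≅ Sᵐ`). Let `X` be path connected with `HomotopyGroup (Fin m) X x` trivial for every
`x`, and let `φ` be continuous on `∂B = (D × {0,1}) ∪ (S × [0,1])`. Then some `Φ`, continuous on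
the box `D × [0, 1]`, agrees with `φ` on `∂B`: the extension of the deformed data
(`exists_extension_one`) on the half-size box, and the deformation itself (`fFun`) read
radially on the collar between the half-size box and `∂B`. [cite: HatcherAT2002, §4.1 (p. 346)] -/
theorem exists_extension [PathConnectedSpace X] (hπ : 1 ≤ m → ∀ x : X, Subsingleton (π_ m X x))
    {φ : (Fin m → ℝ) × ℝ → X} (hφ : ContinuousOn φ (boxBoundary m)) :
    ∃ Φ : (Fin m → ℝ) × ℝ → X, ContinuousOn Φ (D ×ˢ Icc (0 : ℝ) 1) ∧ EqOn Φ φ (boxBoundary m) := by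
  classical
  obtain ⟨G, hGc, hG⟩ := exists_extension_one hπ hφ
  have hfc := fFun_continuousOn hφ
  -- the two branches
  set inner : (Fin m → ℝ) × ℝ → X := fun p => G (ctr m + (2 : ℝ) • (p - ctr m)) with hinner
  set outer : (Fin m → ℝ) × ℝ → X :=
    fun p => fFun φ (2 * (1 - ν (p - ctr m)), ctr m + (ν (p - ctr m))⁻¹ • (p - ctr m)) with houter
  refine ⟨fun p => if ν (p - ctr m) ≤ 1 / 2 then inner p else outer p, ?_, ?_⟩
  · have hνc : Continuous fun p : (Fin m → ℝ) × ℝ => ν (p - ctr m) := by fun_prop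
    refine ContinuousOn.if ?_ ?_ ?_
    · -- agreement on the interface `ν = 1/2`
      rintro p ⟨hp, hfr⟩
      have hν : ν (p - ctr m) = 1 / 2 := frontier_le_subset_eq hνc continuous_const hfr
      have hmem : ctr m + (2 : ℝ) • (p - ctr m) ∈ boxBoundary m := by
        rw [ctr_add_mem_boxBoundary_iff, ν_smul (by norm_num : (0:ℝ) ≤ 2), hν]; norm_num
      show inner p = outer p
      simp only [hinner, houter, hν]
      rw [hG _ hmem]
      norm_num
    · -- the inner branch
      refine hGc.comp (by fun_prop) ?_
      rintro p ⟨hp, hcl⟩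
      have hν : ν (p - ctr m) ≤ 1 / 2 := by
        have := closure_le_eq hνc (continuous_const (y := (1 / 2 : ℝ)))
        rw [this] at hcl
        exact hcl
      rw [ctr_add_mem_box_iff, ν_smul (by norm_num : (0:ℝ) ≤ 2)]
      linarith
    · -- the outer branch
      have hcl : closure {p : (Fin m → ℝ) × ℝ | ¬ν (p - ctr m) ≤ 1 / 2} ⊆ {p | 1 / 2 ≤ ν (p - ctr m)} := by
        have : {p : (Fin m → ℝ) × ℝ | ¬ν (p - ctr m) ≤ 1 / 2} = {p | 1 / 2 < ν (p - ctr m)} := by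
          ext p; exact not_le
        rw [this]
        exact closure_lt_subset_le continuous_const hνc
      have hν0 : ∀ p : (Fin m → ℝ) × ℝ, p ∈ (D ×ˢ Icc (0 : ℝ) 1) ∩
          closure {p : (Fin m → ℝ) × ℝ | ¬ν (p - ctr m) ≤ 1 / 2} → 1 / 2 ≤ ν (p - ctr m) ∧ ν (p - ctr m) ≤ 1 := by
        rintro p ⟨hp, hc⟩
        refine ⟨hcl hc, ?_⟩
        rw [← ctr_add_mem_box_iff, add_sub_cancel]
        exact hp
      refine hfc.comp ?_ ?_
      · have hinv : ContinuousOn (fun p : (Fin m → ℝ) × ℝ => (ν (p - ctr m))⁻¹)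
            ((D ×ˢ Icc (0 : ℝ) 1) ∩ closure {p : (Fin m → ℝ) × ℝ | ¬ν (p - ctr m) ≤ 1 / 2}) :=
          (hνc.continuousOn).inv₀ fun p hp => by linarith [(hν0 p hp).1]
        have hsm : ContinuousOn (fun p : (Fin m → ℝ) × ℝ => (ν (p - ctr m))⁻¹ • (p - ctr m))
            ((D ×ˢ Icc (0 : ℝ) 1) ∩ closure {p : (Fin m → ℝ) × ℝ | ¬ν (p - ctr m) ≤ 1 / 2}) :=
          hinv.smul (continuous_id.sub continuous_const).continuousOn
        exact ContinuousOn.prodMk (continuous_const.mul (continuous_const.sub hνc)).continuousOn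
          (continuousOn_const.add hsm)
      · intro p hp
        obtain ⟨h1, h2⟩ := hν0 p hp
        have hpos : 0 < ν (p - ctr m) := by linarith
        refine ⟨⟨by linarith, by linarith⟩, ?_⟩
        rw [ctr_add_mem_boxBoundary_iff, ν_smul (inv_nonneg.2 hpos.le), inv_mul_cancel₀ hpos.ne']
  · intro p hp
    have hν : ν (p - ctr m) = 1 := by
      rw [← ctr_add_mem_boxBoundary_iff, add_sub_cancel]; exact hp
    have hcond : ¬ ν (p - ctr m) ≤ 1 / 2 := by rw [hν]; norm_num
    show (if ν (p - ctr m) ≤ 1 / 2 then inner p else outer p) = φ p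
    rw [if_neg hcond, houter]
    dsimp only
    rw [hν]
    norm_num
    exact fFun_zero φ hp

end BoxExt

end Literature.AlgebraicTopology.Homotopy

end
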